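import Summits.CriticalPhenomena.PercolationContinuityZ3.Theorems.PercNearOneGluingNoHeavyPcintNawFreeMemKernelClaimsCert
import Literature.Probability.LatticeModels.LatticeGraphProofs
import HarnessLib

/-!
# PCINT lane, reduction B2d on the dangerous-set automaton — the claims certificate with a FAST adjacency test

Cell `prim-pcint` (PAPER-2 track (iii)), seat `prim-pcint-1` (gen 8); support file (`--supports stmt-CriticalPhenomena-4575`).
Does NOT build on p205010.  Memo: prim-pcint-1/gen8/README.md ("PART 2 addenda").

The kernel mirrors test adjacency of integer lists with `WinK.adjL` (for each axis, two list equalities against `x ± eᵢ`), which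
dominates the cost of `NawK.checkRowW`.  Here adjacency is tested as `ℓ¹(x - y) = 1` (`NawK.adjD`), which is the same Boolean on
lists of length `d` (`adjD_eq_adjL`, from `zdGraph_adj_iff_norm_holds`); the step, incidence and certification mirrors are copied
with `adjD` (`nstepKD`, `fincKD`, `fcertKD`, …) and shown EQUAL to the originals on well-formed data, so the fast row check
`NawK.checkRowWD` equals `NawK.checkRowW` (`checkRowWD_eq`) and **`NawK.le_siteCriticalProb_of_checkRowsWD`** follows.
-/

namespace Summit.CriticalPhenomena.PercolationContinuityZ3.Theorems.Pcint

open Finset Literature.Probability.Percolation Literature.Probability.LatticeModels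

namespace NawK

open WinK (toSite toL addL adjL toSite_addL toSite_toL adj_iff_adjL toSite_inj length_toL length_addL)

variable {d : ℕ}

/-! ### Fast adjacency -/

/-- Fast adjacency test: `ℓ¹(x - y) = 1`. [folklore] -/
def adjD (x y : List ℤ) : Bool := l1L (subL x y) == 1

/-- On lists of length `d` the fast test is `WinK.adjL`. [folklore] -/
theorem adjD_eq_adjL {x y : List ℤ} (hx : x.length = d) (hy : y.length = d) : adjD x y = adjL d x y := by
  rw [Bool.eq_iff_iff, adjD, beq_iff_eq, ← adj_iff_adjL hx hy, zdGraph_adj_iff_norm_holds, ← l1_toSite (length_subL hx hy),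
    toSite_subL hx hy, l1]
  constructor
  · intro h
    have : ((∑ i, (( toSite x - toSite y : Site d) i).natAbs : ℕ) : ℤ) = 1 := by exact_mod_cast h
    rw [Nat.cast_sum] at this
    simpa [Int.natCast_natAbs] using this
  · intro h
    have : ((∑ i, (( toSite x - toSite y : Site d) i).natAbs : ℕ) : ℤ) = 1 := by
      rw [Nat.cast_sum]; simpa [Int.natCast_natAbs] using h
    exact_mod_cast this

/-- `List.any` with pointwise-equal predicates. [folklore] -/
theorem any_congr_mem {α : Type*} {l : List α} {p q : α → Bool} (h : ∀ x ∈ l, p x = q x) : l.any p = l.any q := by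
  induction l with
  | nil => rfl
  | cons y ys ih =>
    simp only [List.any_cons]
    rw [h y (by simp), ih fun x hx => h x (by simp [hx])]

/-! ### Fast copies of the mirrors -/

/-- Fast NAW step. [folklore] -/
def nstepKD (τ d : ℕ) (L : KState) (a : Fin d × Bool) : Option KState :=
  if L.any (fun q => decide (q.1 = toL d a) || adjD q.1 (toL d a)) then none
  else some ((negL (toL d a), 1) :: L.filterMap fun q =>
    if q.2 + 1 ≤ τ - 1 ∧ l1L (subL q.1 (toL d a)) ≤ τ - (q.2 + 1) then some (subL q.1 (toL d a), q.2 + 1) else none)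

/-- Fast visible incidences. [folklore] -/
def fincKD (K : KState) (w : List ℤ) : KState := K.filter fun q => adjD q.1 w

/-- Fast certification. [folklore] -/
def fcertKD (τ : ℕ) (K : KState) (u : List ℤ) : Bool :=
  K.any fun q => decide (1 ≤ q.2) && decide (q.2 + 1 + l1L u ≤ τ) && adjD q.1 u

/-- Fast free neighbours. [folklore] -/
def ffreeLD (τ d : ℕ) (K : KState) (w : List ℤ) : List (List ℤ) :=
  (nbrL d w).filter fun u => !isPosK K u && !fcertKD τ K u

/-- Fast count. [folklore] -/
def fcntKD (τ d : ℕ) (K : KState) (w : List ℤ) : ℕ := (fincKD K w).length + (ffreeLD τ d K w).length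

/-- Fast prepay. [folklore] -/
def fprepayKD (kt : ℕ) (K : KState) (w : List ℤ) : Bool := (fincKD K w).any fun q => decide (q.2 + 2 = kt)

/-- Fast self. [folklore] -/
def fselfKD (τ kt : ℕ) (K : KState) (w : List ℤ) : Bool :=
  decide (kt + 3 + l1L w ≤ τ) && ((fincKD K w).all fun q => !(q.2 == kt + 2)) && decide (2 ≤ (fincKD K w).length)

/-- Fast npay. [folklore] -/
def fnpayKD (τ kt : ℕ) (K : KState) (w : List ℤ) : ℕ :=
  (if fprepayKD kt K w then 1 else 0) + (if fselfKD τ kt K w then 1 else 0)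

/-- Fast uncond. [folklore] -/
def funcondKD (K : KState) (w : List ℤ) : Bool :=
  (fincKD K w).any fun q => (fincKD K w).any fun q' => decide (q.2 + 4 ≤ q'.2)

section CheckWD

variable (τ kt d N pn D lamN lamD : ℕ) (QL : List ℕ) (syms : List (List (ℕ × Bool))) (wt : WT)

/-- Fast unconditional claim check. [folklore] -/
def claimOKUD (K : KState) (P : List ℤ) (c : UClaim) : Bool :=
  decide (c.1.length = d) && adjD P c.1 && !isPosK K c.1 && decide (c.2.1 ≤ fnpayKD τ kt K c.1) &&
    decide (fcntKD τ d K c.1 ≤ c.2.2) && funcondKD K c.1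

/-- Fast corner claim check. [folklore] -/
def claimOKCD (K : KState) (P : List ℤ) (c : UClaim) : Bool :=
  decide (c.1.length = d) && adjD P c.1 && !isPosK K c.1 && decide (1 ≤ c.2.1) && decide (c.2.1 ≤ fnpayKD τ kt K c.1) &&
    decide (fcntKD τ d K c.1 ≤ c.2.2) && fcornerK kt K c.1

/-- Fast claims check. [folklore] -/
def claimsOKD (K : KState) (cl : LClaims) : Bool :=
  match posAtK K kt with
  | none => cl.1.isEmpty && cl.2.isNone
  | some P => decide (cl.1.length ≤ 2 * d) && cl.1.all (claimOKUD τ kt d K P) &&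
      (match cl.2 with | none => true | some c => claimOKCD τ kt d K P c) &&
      decide ((cl.1.map Prod.fst ++ cl.2.toList.map Prod.fst).Nodup)

/-- Fast match test. [folklore] -/
def termOKD (L : KState) (a : Fin d × Bool) (os : Option (ℕ × ℕ)) : Bool :=
  match nstepKD τ d L a, os with
  | none, none => true
  | some T, some (j, c) => decide (j < N) && decide (c < syms.length) && seteqK T (actK (syms.getD c []) (stOf wt.toNT j))
  | _, _ => false

/-- **Fast row check** (same Boolean as `checkRowW`). [folklore] -/
def checkRowWD (i : ℕ) : Bool :=
  match wt.find i with
  | none => false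
  | some v =>
    WF d v.2.1 && AOK v.2.1 && decide (1 ≤ v.1) &&
      (letters d).all (fun a => termOKD τ d N syms wt v.2.1 a (v.2.2.1.getD (letterIdx a) none)) &&
      (letters d).all (fun a => claimsOKD τ kt d (fKK d v.2.1 a) (v.2.2.2.getD (letterIdx a) ([], none))) &&
      decide (lamD * rowValW d pn D QL wt (fun k => v.2.2.1.getD k none) (fun k => v.2.2.2.getD k ([], none)) ≤
        lamN * 2 * D ^ (8 * d + 1) * v.1)

end CheckWD

/-! ### The fast copies are the originals on well-formed data -/

section Eq

variable {τ kt : ℕ}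

/-- `nstepKD = nstepK` on well-formed states. [folklore] -/
theorem nstepKD_eq {L : KState} (hL : WF d L = true) (a : Fin d × Bool) : nstepKD τ d L a = nstepK τ d L a := by
  unfold nstepKD nstepK
  rw [any_congr_mem (fun q hq => by rw [adjD_eq_adjL (length_of_WF hL hq) (length_toL a)])]

/-- `fincKD = fincK` on a well-formed known list. [folklore] -/
theorem fincKD_eq {K : KState} (hK : WF d K = true) {w : List ℤ} (hw : w.length = d) : fincKD K w = fincK d K w := by
  unfold fincKD fincK
  exact List.filter_congr fun q hq => by rw [adjD_eq_adjL (length_of_WF hK hq) hw]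

/-- `fcertKD = fcertK` on a well-formed known list. [folklore] -/
theorem fcertKD_eq {K : KState} (hK : WF d K = true) {u : List ℤ} (hu : u.length = d) : fcertKD τ K u = fcertK τ d K u := by
  unfold fcertKD fcertK
  exact any_congr_mem fun q hq => by rw [adjD_eq_adjL (length_of_WF hK hq) hu]

/-- `ffreeLD = ffreeL` on a well-formed known list. [folklore] -/
theorem ffreeLD_eq {K : KState} (hK : WF d K = true) {w : List ℤ} (hw : w.length = d) : ffreeLD τ d K w = ffreeL τ d K w := by
  unfold ffreeLD ffreeL
  exact List.filter_congr fun u hu => by rw [fcertKD_eq hK (length_of_mem_nbrL hw hu)]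

/-- `fcntKD = fcntK`. [folklore] -/
theorem fcntKD_eq {K : KState} (hK : WF d K = true) {w : List ℤ} (hw : w.length = d) : fcntKD τ d K w = fcntK τ d K w := by
  rw [fcntKD, fcntK, fincKD_eq hK hw, ffreeLD_eq hK hw]

/-- `fnpayKD = fnpayK`. [folklore] -/
theorem fnpayKD_eq {K : KState} (hK : WF d K = true) {w : List ℤ} (hw : w.length = d) : fnpayKD τ kt K w = fnpayK τ kt d K w := by
  rw [fnpayKD, fnpayK, fprepayKD, fprepayK, fselfKD, fselfK, fincKD_eq hK hw]

/-- `funcondKD = funcondK`. [folklore] -/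
theorem funcondKD_eq {K : KState} (hK : WF d K = true) {w : List ℤ} (hw : w.length = d) : funcondKD K w = funcondK d K w := by
  rw [funcondKD, funcondK, fincKD_eq hK hw]

/-- `claimOKUD = claimOKU`. [folklore] -/
theorem claimOKUD_eq {K : KState} (hK : WF d K = true) {P : List ℤ} (hP : P.length = d) (c : UClaim) :
    claimOKUD τ kt d K P c = claimOKU τ kt d K P c := by
  unfold claimOKUD claimOKU
  by_cases hc : c.1.length = d
  · rw [adjD_eq_adjL hP hc, fnpayKD_eq hK hc, fcntKD_eq hK hc, funcondKD_eq hK hc]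
  · simp [hc]

/-- `claimOKCD = claimOKC`. [folklore] -/
theorem claimOKCD_eq {K : KState} (hK : WF d K = true) {P : List ℤ} (hP : P.length = d) (c : UClaim) :
    claimOKCD τ kt d K P c = claimOKC τ kt d K P c := by
  unfold claimOKCD claimOKC
  by_cases hc : c.1.length = d
  · rw [adjD_eq_adjL hP hc, fnpayKD_eq hK hc, fcntKD_eq hK hc]
  · simp [hc]

/-- `claimsOKD = claimsOK` on the known list of a well-formed state with valid ages. [folklore] -/
theorem claimsOKD_eq {L : KState} (hL : WF d L = true) (hA : AOK L = true) (a : Fin d × Bool) (cl : LClaims) :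
    claimsOKD τ kt d (fKK d L a) cl = claimsOK τ kt d (fKK d L a) cl := by
  have hK := WF_fKK hL a
  unfold claimsOKD claimsOK
  cases hP : posAtK (fKK d L a) kt with
  | none => rfl
  | some P =>
    have lP : P.length = d := length_of_WF hK ((posAtK_eq_some_iff hA).1 hP)
    simp only
    have hfun : claimOKUD τ kt d (fKK d L a) P = claimOKU τ kt d (fKK d L a) P := funext fun c => claimOKUD_eq hK lP c
    rw [hfun]
    cases cl.2 with
    | none => rfl
    | some c => simp only [claimOKCD_eq hK lP c]

variable {N : ℕ} {syms : List (List (ℕ × Bool))} {wt : WT}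

/-- `termOKD = termOK` on well-formed states. [folklore] -/
theorem termOKD_eq {L : KState} (hL : WF d L = true) (a : Fin d × Bool) (os : Option (ℕ × ℕ)) :
    termOKD τ d N syms wt L a os = termOK τ d N syms wt.toNT L a os := by
  unfold termOKD termOK; rw [nstepKD_eq hL]; rfl

variable {pn D lamN lamD : ℕ} {QL : List ℕ}

/-- **The fast row check is the row check.** [folklore] -/
theorem checkRowWD_eq (i : ℕ) :
    checkRowWD τ kt d N pn D lamN lamD QL syms wt i = checkRowW τ kt d N pn D lamN lamD QL syms wt i := by
  unfold checkRowWD checkRowW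
  cases wt.find i with
  | none => rfl
  | some v =>
    simp only
    by_cases hL : WF d v.2.1 = true
    · by_cases hA : AOK v.2.1 = true
      · simp only [termOKD_eq (τ := τ) (N := N) (syms := syms) (wt := wt) hL, claimsOKD_eq (τ := τ) (kt := kt) hL hA]
      · rw [Bool.not_eq_true] at hA; simp [hA]
    · rw [Bool.not_eq_true] at hL; simp [hL]

end Eq

/-- **Soundness of the fast claims certificate** (`checkRowWD` for `checkRowW`). [folklore] -/
theorem le_siteCriticalProb_of_checkRowsWD {τ kt d N pn D lamN lamD : ℕ} {QL : List ℕ} {syms : List (List (ℕ × Bool))}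
    {wt : WT} [NeZero d] (hτ : 2 ≤ τ) (hkt : 2 * kt ≤ τ) (hkt2 : 2 ≤ kt) (sym : ℕ → SPerm d)
    (hsyms : ∀ c < syms.length, syms.getD c [] = spermKL (sym c))
    (hrows : ∀ i < N, checkRowWD τ kt d N pn D lamN lamD QL syms wt i = true)
    (hN : 0 < N) (h0 : stOf wt.toNT 0 = []) (hD : 0 < D) (hpn : pn ≤ D) (hQ : QLok d pn D QL = true) (hlam : lamN < lamD) :
    (pn : ℝ) / D ≤ siteCriticalProb (zdGraph d) 0 :=
  le_siteCriticalProb_of_checkRowsW hτ hkt hkt2 sym hsyms (fun i hi => by rw [← checkRowWD_eq]; exact hrows i hi)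
    hN h0 hD hpn hQ hlam

end NawK

end Summit.CriticalPhenomena.PercolationContinuityZ3.Theorems.Pcint
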